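import Mathlib
import HarnessLib

/-!
# Route ParityLeakOneFifth, crux `PlainSplit` (stmt-Parity-18382), skeleton `calib-split`:
# tools for stub `stub_roughLiouvilleTwistedSmall`, III — summing the remainder classes

Book-keeping for the remainder of the signed sieve for `S_d`: an injective re-indexing bound
(`sum_le_sum_of_injOn_nonneg`), the admissible classes of a modulus `e` injected into the divisors
`g ∣ e` (`sum_adm_le_sum_divisors`), the pairs `(e, g ∣ e)`, `e ≤ L`, injected into the pairs
`(g ≤ L, e' ≤ L/g)` (`sum_divisors_pairs_le`), and Bombieri–Vinogradov with one class per modulus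
turned into a bound for the maximum over the reduced classes (`sum_maxClass_le`).
-/

namespace Summit.Parity.GeneralizedHardyLittlewood.Theorems.ParityLeakOneFifth

open Finset

/-- Re-indexing bound: if `key` is injective on `s` with values in `t`, `T c ≤ F (key c)` and
`F ≥ 0` on `t`, then `Σ_s T ≤ Σ_t F`. -/
theorem sum_le_sum_of_injOn_nonneg {ι κ : Type*} [DecidableEq κ] (s : Finset ι) (t : Finset κ)
    (T : ι → ℝ) (F : κ → ℝ) (key : ι → κ) (hmaps : ∀ c ∈ s, key c ∈ t) (hinj : Set.InjOn key s)
    (hle : ∀ c ∈ s, T c ≤ F (key c)) (hF : ∀ g ∈ t, 0 ≤ F g) :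
    ∑ c ∈ s, T c ≤ ∑ g ∈ t, F g := by
  calc ∑ c ∈ s, T c ≤ ∑ c ∈ s, F (key c) := Finset.sum_le_sum hle
    _ = ∑ g ∈ s.image key, F g := (Finset.sum_image hinj).symm
    _ ≤ ∑ g ∈ t, F g :=
        Finset.sum_le_sum_of_subset_of_nonneg (Finset.image_subset_iff.2 hmaps)
          (fun g hg _ => hF g hg)

/-- The admissible classes modulo `e`, keyed injectively by `g = (K₀ + c mod e, e) ∣ e`:
`Σ_{c admissible} T(c) ≤ Σ_{g ∣ e} F(g, e/g)` whenever `T(c) ≤ F(g(c), e/g(c))` and `F ≥ 0`. -/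
theorem sum_adm_le_sum_divisors {e K₀ : ℕ} (he : e ≠ 0) (A : Finset ℕ)
    (huniq : ∀ c₁ ∈ A, ∀ c₂ ∈ A,
      Nat.gcd ((K₀ + c₁) % e) e = Nat.gcd ((K₀ + c₂) % e) e → c₁ = c₂)
    (T : ℕ → ℝ) (F : ℕ → ℕ → ℝ) (hF : ∀ g e', 0 ≤ F g e')
    (hle : ∀ c ∈ A, T c ≤ F (Nat.gcd ((K₀ + c) % e) e) (e / Nat.gcd ((K₀ + c) % e) e)) :
    ∑ c ∈ A, T c ≤ ∑ g ∈ e.divisors, F g (e / g) := by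
  refine sum_le_sum_of_injOn_nonneg A e.divisors T (fun g => F g (e / g))
    (fun c => Nat.gcd ((K₀ + c) % e) e) ?_ ?_ hle (fun g _ => hF g _)
  · intro c _
    exact Nat.mem_divisors.2 ⟨Nat.gcd_dvd_right _ _, he⟩
  · intro c₁ hc₁ c₂ hc₂ h
    exact huniq c₁ hc₁ c₂ hc₂ h

/-- The pairs `(e, g)` with `e ∣ P`, `e ≤ L`, `g ∣ e` inject into the pairs `(g, e')` with
`g ≤ ⌊L⌋`, `e' ≤ ⌊L⌋/g` via `e' = e/g`. -/
theorem sum_divisors_pairs_le (P : ℕ) (L : ℝ) (F : ℕ → ℕ → ℝ)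
    (hF : ∀ g e', 0 ≤ F g e') :
    ∑ e ∈ P.divisors.filter (fun e : ℕ => (e : ℝ) ≤ L), ∑ g ∈ e.divisors, F g (e / g) ≤
      ∑ g ∈ Finset.Icc 1 ⌊L⌋₊, ∑ e' ∈ Finset.Icc 1 (⌊L⌋₊ / g), F g e' := by
  rw [Finset.sum_sigma', Finset.sum_sigma']
  refine sum_le_sum_of_injOn_nonneg _ _ (fun x : (Σ _ : ℕ, ℕ) => F x.2 (x.1 / x.2))
    (fun y : (Σ _ : ℕ, ℕ) => F y.1 y.2)
    (fun x : (Σ _ : ℕ, ℕ) => (⟨x.2, x.1 / x.2⟩ : Σ _ : ℕ, ℕ)) ?_ ?_ (fun _ _ => le_rfl)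
    (fun y _ => hF _ _)
  · rintro ⟨e, g⟩ hx
    rw [Finset.mem_sigma, Finset.mem_filter, Nat.mem_divisors, Nat.mem_divisors] at hx
    obtain ⟨⟨⟨heP, -⟩, heL⟩, hge, he0⟩ := hx
    have hg0 : 0 < g := Nat.pos_of_dvd_of_pos hge (Nat.pos_of_ne_zero he0)
    have hgle : g ≤ e := Nat.le_of_dvd (Nat.pos_of_ne_zero he0) hge
    have heLf : e ≤ ⌊L⌋₊ := Nat.le_floor heL
    rw [Finset.mem_sigma, Finset.mem_Icc, Finset.mem_Icc]
    exact ⟨⟨hg0, hgle.trans heLf⟩, Nat.div_pos hgle hg0, Nat.div_le_div_right heLf⟩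
  · rintro ⟨e₁, g₁⟩ hx₁ ⟨e₂, g₂⟩ hx₂ h
    simp only [Finset.mem_coe, Finset.mem_sigma, Nat.mem_divisors] at hx₁ hx₂
    simp only [Sigma.mk.inj_iff, heq_eq_eq] at h
    obtain ⟨hg, hq⟩ := h
    subst hg
    have h1 : e₁ = g₁ * (e₁ / g₁) := (Nat.mul_div_cancel' hx₁.2.1).symm
    have h2 : e₂ = g₁ * (e₂ / g₁) := (Nat.mul_div_cancel' hx₂.2.1).symm
    have : e₁ = e₂ := by rw [h1, h2, hq]
    subst this
    rfl

/-- **Bombieri–Vinogradov for the maximal reduced class.**  If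
`Σ_{q ≤ Q} |Σ_{m ≤ N_q, m ≡ a_q (q)} λ(m)| ≤ R` for every choice of heights `N_q ≤ X` and units
`a_q`, then `Σ_{q ≤ Q} max_{(u,q)=1} |Σ_{m ≤ N, m ≡ u (q)} λ(m)| ≤ R` for `N ≤ X`. -/
theorem sum_maxClass_le {Q : ℕ} {X R : ℝ} (N : ℕ) (hN : (N : ℝ) ≤ X)
    (hBV : ∀ N' : ℕ → ℕ, (∀ q, (N' q : ℝ) ≤ X) → ∀ a : (q : ℕ) → ZMod q,
      (∀ q ∈ Finset.Icc 1 Q, IsUnit (a q)) →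
      ∑ q ∈ Finset.Icc 1 Q, |∑ m ∈ (Finset.Icc 1 (N' q)).filter (fun m : ℕ => (m : ZMod q) = a q),
        (ArithmeticFunction.liouville m : ℝ)| ≤ R) :
    ∑ q ∈ Finset.Icc 1 Q,
      (if h : ((Finset.range q).filter (fun u : ℕ => Nat.Coprime u q)).Nonempty then
        ((Finset.range q).filter (fun u : ℕ => Nat.Coprime u q)).sup' h (fun u : ℕ =>
          |∑ m ∈ (Finset.Icc 1 N).filter (fun m : ℕ => (m : ZMod q) = (u : ZMod q)),
            (ArithmeticFunction.liouville m : ℝ)|)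
      else 0) ≤ R := by
  classical
  -- the maximising class
  set f : (q : ℕ) → ℕ → ℝ := fun q u =>
    |∑ m ∈ (Finset.Icc 1 N).filter (fun m : ℕ => (m : ZMod q) = (u : ZMod q)),
      (ArithmeticFunction.liouville m : ℝ)| with hf
  set a : (q : ℕ) → ZMod q := fun q =>
    if h : ((Finset.range q).filter (fun u : ℕ => Nat.Coprime u q)).Nonempty then
      ((Classical.choose (Finset.exists_mem_eq_sup' h (f q)) : ℕ) : ZMod q)
    else 1 with ha
  have hunit : ∀ q ∈ Finset.Icc 1 Q, IsUnit (a q) := by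
    intro q _
    simp only [ha]
    split_ifs with h
    · obtain ⟨hmem, -⟩ := Classical.choose_spec (Finset.exists_mem_eq_sup' h (f q))
      rw [Finset.mem_filter] at hmem
      exact (ZMod.isUnit_iff_coprime _ _).2 hmem.2
    · exact isUnit_one
  have h := hBV (fun _ => N) (fun _ => hN) a hunit
  refine le_trans (Finset.sum_le_sum fun q _ => ?_) h
  simp only [ha]
  split_ifs with hne
  · obtain ⟨-, heq⟩ := Classical.choose_spec (Finset.exists_mem_eq_sup' hne (f q))
    exact heq.le
  · exact abs_nonneg _

end Summit.Parity.GeneralizedHardyLittlewood.Theorems.ParityLeakOneFifth
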